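import Summits.QuantumFields.YangMills.Theorems.SmallFieldWideningLargeFieldMassRefinementTailPlainStab
import Summits.QuantumFields.YangMills.Theorems.SmallFieldWideningLargeFieldMassRefinementTailCondStabDensity
import Literature.MathematicalPhysics.QuantumFieldTheory.Balaban1983to89.T4PairDerivBridge

/-!
# Route `SmallFieldWidening`, crux r3 `LargeFieldMassRefinementTail` (stmt-QuantumFields-22884), line `birth` v6 — `PlainStab` IN BAŁABAN'S DENSITY CURRENCY: the
# unconditioned unit-plaquette tail is the normalised large-plaquette part of the FULL terminal effective density `ρ̂_K = T^K(e^{−β_K A})`, so the one-step hypothesis of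
# `…PlainStab` compares `ρ̂_{K+1}` and `ρ̂_K` (consecutive runs, one local event, both normalisations divided out)
# (support file; width seat `ym-line-sfw-p2-w2` gen 17; the stub, the three cruxes and rung R3 stay OPEN)

WHAT THIS IS NOT.  No estimate of Bałaban's programme is proved; nothing bears on the Yang–Mills mass gap; rung R3 (`YM3TorusSU2`) is a RECORD rung.  The dictionary:

* §1 ★ `plainTail_eq_densityRatio` — for every run `K`, threshold `t` and unit plaquette `p` (label `q`):
  `Gibbs_K{ t ≤ |Ū^K(∂p) − 1| } = (∫_{t ≤ |u(∂q)−1|} ρ̂_K du)/(∫ ρ̂_K du)`, `ρ̂_K` the tree's terminal unit density (`T3UnitLawDensityEML.unitDensity` =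
  `resUnitDensity … univ`) — the companion conditional identity `…CondStabDensity.cond_unitTop_eq_densityRatio` at the trivial profile `θ ≡ 3` (every history is small since
  `dist1 ≤ 2` on `SU(2)`).
* §2 ★ `deepStub_of_plainDensityStep` and the by-name certificates `firstExitWindowTailL_of_plainDensityStep`, `largeFieldMassRefinementTail_of_plainDensityStep`,
  `historyTailL_of_plainDensityStep`: the shared stub and the three cruxes (26243, 22884, 19936) from the one-step comparison
  `ratio_{K+1}(q) ≤ e^{ρ_K}·ratio_K(q)` of these density ratios, uniform in the volume, accumulated slack sub-Gaussian — [King1986] Thm 3.4's two-cutoff comparison of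
  effective densities, ONE-SIDED and read on ONE local event instead of in sup norm.

References: T. Bałaban, Commun. Math. Phys. **102** (1985) 255–275 [Balaban1985UV3] ((2) p.256, (6)–(7) p.257, (70)–(71) p.273); C. King, CMP **102** (1986) 649–677
[King1986] (Thm 3.4 (3.9) p.656).
-/

noncomputable section

open MeasureTheory Filter Topology ProbabilityTheory
open Literature.MathematicalPhysics.QuantumFieldTheory.Balaban1983to89
open Literature.MathematicalPhysics.QuantumFieldTheory.Balaban1983to89.Missing
open Literature.MathematicalPhysics.QuantumFieldTheory.Balaban1983to89.T3ContinuumYM3Torus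
open Literature.MathematicalPhysics.QuantumFieldTheory.Balaban1983to89.T3UnitScaleTilt
open Literature.MathematicalPhysics.QuantumFieldTheory.Balaban1983to89.T3UnitLawDensityEML (ℰp measurableE_ℰp unitDensity)
open Literature.MathematicalPhysics.QuantumFieldTheory.Balaban1983to89.T3LevelShift
open Literature.MathematicalPhysics.QuantumFieldTheory.Balaban1983to89.T3RestrictedUnitDensity
open Literature.MathematicalPhysics.QuantumFieldTheory.Balaban1983to89.T4PairDerivBridge (dist1_le_two_specialUnitaryGroup)
open Summit.QuantumFields.YangMills.Theorems.LargeFieldMassRefinementTailCondStabDensity (cond_unitTop_eq_densityRatio)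
open Summit.QuantumFields.YangMills.Theorems.LargeFieldMassRefinementTailPlainStab (deepStub_of_plainStab unitTop_of_plainStab)
open Summit.QuantumFields.YangMills.Theorems.LargeFieldMassRefinementTailUnitTop
  (firstExitWindowTailL_of_unitTop largeFieldMassRefinementTail_of_unitTop historyTailL_of_unitTop)

namespace Summit.QuantumFields.YangMills.Theorems.LargeFieldMassRefinementTailPlainStabDensity

/-! ## §1 The unconditioned unit tail is a ratio of two integrals of the full terminal density -/

section Ratio

variable (F : T3Family) {γ : ℝ} (K : ℕ)

/-- At the trivial profile `θ ≡ 3` every sub-unit history is small (`dist1 ≤ 2 < 3` on `SU(2)`): `histGood … 3 K 1 = univ`. [folklore] -/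
theorem histGood_three_eq_univ : histGood F ℰp (fun _ => (3 : ℝ)) K 1 = Set.univ := by
  refine Set.eq_univ_of_forall fun U => ?_
  simp only [histGood, Set.mem_setOf_eq]
  intro j _ p
  exact lt_of_le_of_lt (dist1_le_two_specialUnitaryGroup _) (by norm_num)

/-- ★ **THE UNCONDITIONED UNIT-PLAQUETTE TAIL IN THE DENSITY CURRENCY**: `Gibbs_K{ t ≤ |Ū^K(∂p) − 1| } = (∫_{t ≤ |u(∂q)−1|} ρ̂_K du)/(∫ ρ̂_K du)` with `ρ̂_K` the terminal
unit density of the tree (`unitDensity`, `= resUnitDensity … univ`). [cite: Balaban1985UV3, (2) p.256 and (6)-(7) p.257] -/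
theorem plainTail_eq_densityRatio (hγ : 0 ≤ γ) (t : ℝ) (p : Plaq (F.P K) K) :
    (gibbsK F ℰp γ K).real {U | t ≤ GaugeGroup.dist1 (GaugeField.plaqHol
        (Averaging.iter (fun i => BlockAveraging.blockAvg (P := F.P K) (j := i) ℰp) K U) p)} =
      (∫ u in {u | t ≤ GaugeGroup.dist1 (GaugeField.plaqHol u ((plaqShift (F.sitesPerDir_unit K)).symm p))},
          unitDensity F γ K u ∂fieldMeasure (F.P 0) 0 (Matrix.specialUnitaryGroup (Fin 2) ℂ)) /
        ∫ u, unitDensity F γ K u ∂fieldMeasure (F.P 0) 0 (Matrix.specialUnitaryGroup (Fin 2) ℂ) := by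
  haveI := isProbabilityMeasure_gibbsK F ℰp hγ K
  have key := cond_unitTop_eq_densityRatio F K hγ (fun _ => (3 : ℝ)) t p
  rw [histGood_three_eq_univ, cond_univ] at key
  simp_rw [resUnitDensity_univ] at key
  exact key

end Ratio

/-! ## §2 The stub and the three cruxes from the one-step comparison of the full density ratios -/

section Step

/-- ★ **THE UNIT-TOP TAIL (uniform) FROM THE ONE-STEP DENSITY COMPARISON `PlainDensityStep`** — `PlainStab` of the companion file with every unconditioned unit tail
rewritten as `∫_{E_q}ρ̂_K / ∫ρ̂_K` (§1): one more ultraviolet level (`ρ̂_{K+1} = T^{K+1}(e^{−β_{K+1}A})` against `ρ̂_K = T^K(e^{−β_K A})`) raises the normalised mass of ONE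
large unit plaquette by at most `e^{ρ_K}`, accumulated slack `≤ A_η + η·p(√γ)²`, uniformly in the volume. [cite: King1986, Thm 3.4 (3.9) p.656; Balaban1985UV3, (70)-(71) p.273] -/
theorem unitTop_of_plainDensityStep
    (hDS : ∀ (L : ℕ) (b₀ p₀ : ℝ), 0 < b₀ → 2 < p₀ → ∃ γ₁ : ℝ, 0 < γ₁ ∧ γ₁ ≤ 1 ∧
      ∀ η : ℝ, 0 < η → ∃ A : ℝ, ∀ (F : T3Family) (γ : ℝ), F.L = L → 0 < γ → γ ≤ γ₁ →
        ∀ q : Plaq (F.P 0) 0, ∃ ρ : ℕ → ℝ,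
          (∀ K : ℕ, ∑ k ∈ Finset.Ico 1 K, ρ k ≤ A + η * B10.pFun b₀ p₀ (Real.sqrt γ) ^ 2) ∧
          ∀ K : ℕ, 1 ≤ K →
            (∫ u in {u | θBal F.L γ b₀ p₀ 0 ≤ GaugeGroup.dist1 (GaugeField.plaqHol u q)},
                unitDensity F γ (K + 1) u ∂fieldMeasure (F.P 0) 0 (Matrix.specialUnitaryGroup (Fin 2) ℂ)) /
              (∫ u, unitDensity F γ (K + 1) u ∂fieldMeasure (F.P 0) 0 (Matrix.specialUnitaryGroup (Fin 2) ℂ)) ≤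
            Real.exp (ρ K) *
            ((∫ u in {u | θBal F.L γ b₀ p₀ 0 ≤ GaugeGroup.dist1 (GaugeField.plaqHol u q)},
                unitDensity F γ K u ∂fieldMeasure (F.P 0) 0 (Matrix.specialUnitaryGroup (Fin 2) ℂ)) /
              (∫ u, unitDensity F γ K u ∂fieldMeasure (F.P 0) 0 (Matrix.specialUnitaryGroup (Fin 2) ℂ)))) :
    ∀ (L : ℕ) (b₀ p₀ : ℝ), 0 < b₀ → 2 < p₀ → ∃ (γ₁ C c : ℝ) (N : ℕ), 0 < γ₁ ∧ γ₁ ≤ 1 ∧ 0 < c ∧ 0 ≤ C ∧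
      ∀ (F : T3Family) (γ : ℝ), F.L = L → 0 < γ → γ ≤ γ₁ → ∀ (K : ℕ), 2 ≤ K → ∀ p : Plaq (F.P K) K,
        (gibbsK F ℰp γ K).real {U | (∀ k, k < K → PlaqSmall (θBal F.L γ b₀ p₀ (K - k))
            (Averaging.iter (fun i => BlockAveraging.blockAvg (P := F.P K) (j := i) ℰp) k U)) ∧
          θBal F.L γ b₀ p₀ 0 ≤ GaugeGroup.dist1 (GaugeField.plaqHol
            (Averaging.iter (fun i => BlockAveraging.blockAvg (P := F.P K) (j := i) ℰp) K U) p)} ≤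
        C * (γ⁻¹) ^ N * Real.exp (-(c * B10.pFun b₀ p₀ (Real.sqrt γ) ^ 2)) := by
  refine unitTop_of_plainStab fun L b₀ p₀ hb₀ hp₀ => ?_
  obtain ⟨γ₁, hγ₁, hγ₁1, h⟩ := hDS L b₀ p₀ hb₀ hp₀
  refine ⟨γ₁, hγ₁, hγ₁1, fun η hη => ?_⟩
  obtain ⟨A, hA⟩ := h η hη
  refine ⟨A, fun F γ hFL hγ hle q => ?_⟩
  obtain ⟨ρ, hρ, hstep⟩ := hA F γ hFL hγ hle q
  refine ⟨ρ, hρ, fun K hK => ?_⟩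
  have h1 := plainTail_eq_densityRatio F (K + 1) hγ.le (θBal F.L γ b₀ p₀ 0) (plaqShift (F.sitesPerDir_unit (K + 1)) q)
  have h2 := plainTail_eq_densityRatio F K hγ.le (θBal F.L γ b₀ p₀ 0) (plaqShift (F.sitesPerDir_unit K) q)
  rw [Equiv.symm_apply_apply] at h1 h2
  rw [h1, h2]
  exact hstep K hK

/-- ★ **THE REGISTERED STUB `stub_firstExitDeep` (text verbatim) FROM `PlainDensityStep`.**  Conditional certificate; nothing about the mass gap.
[cite: Balaban1985UV3, (70)-(71) p.273] -/
theorem deepStub_of_plainDensityStep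
    (hDS : ∀ (L : ℕ) (b₀ p₀ : ℝ), 0 < b₀ → 2 < p₀ → ∃ γ₁ : ℝ, 0 < γ₁ ∧ γ₁ ≤ 1 ∧
      ∀ η : ℝ, 0 < η → ∃ A : ℝ, ∀ (F : T3Family) (γ : ℝ), F.L = L → 0 < γ → γ ≤ γ₁ →
        ∀ q : Plaq (F.P 0) 0, ∃ ρ : ℕ → ℝ,
          (∀ K : ℕ, ∑ k ∈ Finset.Ico 1 K, ρ k ≤ A + η * B10.pFun b₀ p₀ (Real.sqrt γ) ^ 2) ∧
          ∀ K : ℕ, 1 ≤ K →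
            (∫ u in {u | θBal F.L γ b₀ p₀ 0 ≤ GaugeGroup.dist1 (GaugeField.plaqHol u q)},
                unitDensity F γ (K + 1) u ∂fieldMeasure (F.P 0) 0 (Matrix.specialUnitaryGroup (Fin 2) ℂ)) /
              (∫ u, unitDensity F γ (K + 1) u ∂fieldMeasure (F.P 0) 0 (Matrix.specialUnitaryGroup (Fin 2) ℂ)) ≤
            Real.exp (ρ K) *
            ((∫ u in {u | θBal F.L γ b₀ p₀ 0 ≤ GaugeGroup.dist1 (GaugeField.plaqHol u q)},
                unitDensity F γ K u ∂fieldMeasure (F.P 0) 0 (Matrix.specialUnitaryGroup (Fin 2) ℂ)) /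
              (∫ u, unitDensity F γ K u ∂fieldMeasure (F.P 0) 0 (Matrix.specialUnitaryGroup (Fin 2) ℂ)))) :
    ∀ (L : ℕ) (b₀ p₀ b₂ : ℝ), 0 < b₀ → 2 < p₀ → b₀ ≤ b₂ → ∃ (γ₁ C c : ℝ) (N : ℕ), 0 < γ₁ ∧ γ₁ ≤ 1 ∧ 0 < c ∧ 0 ≤ C ∧
      ∀ (F : T3Family) (γ : ℝ), F.L = L → 0 < γ → γ ≤ γ₁ → ∀ (K j : ℕ), 2 ≤ j → j ≤ K → ∀ p : Plaq (F.P K) j,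
        (gibbsK F ℰp γ K).real {U | (∀ k, k < j → PlaqSmall (θBal F.L γ b₀ p₀ (K - k))
            (Averaging.iter (fun i => BlockAveraging.blockAvg (P := F.P K) (j := i) ℰp) k U)) ∧
          PlaqSmall (θBal F.L γ b₂ p₀ (K - j)) (Averaging.iter (fun i => BlockAveraging.blockAvg (P := F.P K) (j := i) ℰp) j U) ∧
          θBal F.L γ b₀ p₀ (K - j) ≤ GaugeGroup.dist1 (GaugeField.plaqHol
            (Averaging.iter (fun i => BlockAveraging.blockAvg (P := F.P K) (j := i) ℰp) j U) p)} ≤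
        C * ((γ * ((F.L : ℝ)⁻¹) ^ (K - j))⁻¹) ^ N * Real.exp (-(c * B10.pFun b₀ p₀ (Real.sqrt (γ * ((F.L : ℝ)⁻¹) ^ (K - j))) ^ 2)) :=
  LargeFieldMassRefinementTailUnitTop.deepStub_iff_unitTop.mpr (unitTop_of_plainDensityStep hDS)

/-- **`FirstExitWindowTailL` (stmt-QuantumFields-26243) ⇐ `PlainDensityStep`.**  Conditional certificate. [cite: Balaban1985UV3, (70)-(71) p.273] -/
theorem firstExitWindowTailL_of_plainDensityStep
    (hDS : ∀ (L : ℕ) (b₀ p₀ : ℝ), 0 < b₀ → 2 < p₀ → ∃ γ₁ : ℝ, 0 < γ₁ ∧ γ₁ ≤ 1 ∧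
      ∀ η : ℝ, 0 < η → ∃ A : ℝ, ∀ (F : T3Family) (γ : ℝ), F.L = L → 0 < γ → γ ≤ γ₁ →
        ∀ q : Plaq (F.P 0) 0, ∃ ρ : ℕ → ℝ,
          (∀ K : ℕ, ∑ k ∈ Finset.Ico 1 K, ρ k ≤ A + η * B10.pFun b₀ p₀ (Real.sqrt γ) ^ 2) ∧
          ∀ K : ℕ, 1 ≤ K →
            (∫ u in {u | θBal F.L γ b₀ p₀ 0 ≤ GaugeGroup.dist1 (GaugeField.plaqHol u q)},
                unitDensity F γ (K + 1) u ∂fieldMeasure (F.P 0) 0 (Matrix.specialUnitaryGroup (Fin 2) ℂ)) /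
              (∫ u, unitDensity F γ (K + 1) u ∂fieldMeasure (F.P 0) 0 (Matrix.specialUnitaryGroup (Fin 2) ℂ)) ≤
            Real.exp (ρ K) *
            ((∫ u in {u | θBal F.L γ b₀ p₀ 0 ≤ GaugeGroup.dist1 (GaugeField.plaqHol u q)},
                unitDensity F γ K u ∂fieldMeasure (F.P 0) 0 (Matrix.specialUnitaryGroup (Fin 2) ℂ)) /
              (∫ u, unitDensity F γ K u ∂fieldMeasure (F.P 0) 0 (Matrix.specialUnitaryGroup (Fin 2) ℂ)))) :
    Summit.QuantumFields.YangMills.Theses.FirstExitWindow.FirstExitWindowTailL :=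
  firstExitWindowTailL_of_unitTop (unitTop_of_plainDensityStep hDS)

/-- **r3 `LargeFieldMassRefinementTail` (stmt-QuantumFields-22884) ⇐ `PlainDensityStep`.**  Conditional certificate. [cite: Balaban1985UV3, (70)-(71) p.273] -/
theorem largeFieldMassRefinementTail_of_plainDensityStep
    (hDS : ∀ (L : ℕ) (b₀ p₀ : ℝ), 0 < b₀ → 2 < p₀ → ∃ γ₁ : ℝ, 0 < γ₁ ∧ γ₁ ≤ 1 ∧
      ∀ η : ℝ, 0 < η → ∃ A : ℝ, ∀ (F : T3Family) (γ : ℝ), F.L = L → 0 < γ → γ ≤ γ₁ →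
        ∀ q : Plaq (F.P 0) 0, ∃ ρ : ℕ → ℝ,
          (∀ K : ℕ, ∑ k ∈ Finset.Ico 1 K, ρ k ≤ A + η * B10.pFun b₀ p₀ (Real.sqrt γ) ^ 2) ∧
          ∀ K : ℕ, 1 ≤ K →
            (∫ u in {u | θBal F.L γ b₀ p₀ 0 ≤ GaugeGroup.dist1 (GaugeField.plaqHol u q)},
                unitDensity F γ (K + 1) u ∂fieldMeasure (F.P 0) 0 (Matrix.specialUnitaryGroup (Fin 2) ℂ)) /
              (∫ u, unitDensity F γ (K + 1) u ∂fieldMeasure (F.P 0) 0 (Matrix.specialUnitaryGroup (Fin 2) ℂ)) ≤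
            Real.exp (ρ K) *
            ((∫ u in {u | θBal F.L γ b₀ p₀ 0 ≤ GaugeGroup.dist1 (GaugeField.plaqHol u q)},
                unitDensity F γ K u ∂fieldMeasure (F.P 0) 0 (Matrix.specialUnitaryGroup (Fin 2) ℂ)) /
              (∫ u, unitDensity F γ K u ∂fieldMeasure (F.P 0) 0 (Matrix.specialUnitaryGroup (Fin 2) ℂ)))) :
    Summit.QuantumFields.YangMills.Theses.SmallFieldWidening.LargeFieldMassRefinementTail :=
  largeFieldMassRefinementTail_of_unitTop (unitTop_of_plainDensityStep hDS)

/-- **K2′ `HistoryTailL` (stmt-QuantumFields-19936) ⇐ `PlainDensityStep`.**  Conditional certificate. [cite: Balaban1985UV3, (70)-(71) p.273] -/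
theorem historyTailL_of_plainDensityStep
    (hDS : ∀ (L : ℕ) (b₀ p₀ : ℝ), 0 < b₀ → 2 < p₀ → ∃ γ₁ : ℝ, 0 < γ₁ ∧ γ₁ ≤ 1 ∧
      ∀ η : ℝ, 0 < η → ∃ A : ℝ, ∀ (F : T3Family) (γ : ℝ), F.L = L → 0 < γ → γ ≤ γ₁ →
        ∀ q : Plaq (F.P 0) 0, ∃ ρ : ℕ → ℝ,
          (∀ K : ℕ, ∑ k ∈ Finset.Ico 1 K, ρ k ≤ A + η * B10.pFun b₀ p₀ (Real.sqrt γ) ^ 2) ∧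
          ∀ K : ℕ, 1 ≤ K →
            (∫ u in {u | θBal F.L γ b₀ p₀ 0 ≤ GaugeGroup.dist1 (GaugeField.plaqHol u q)},
                unitDensity F γ (K + 1) u ∂fieldMeasure (F.P 0) 0 (Matrix.specialUnitaryGroup (Fin 2) ℂ)) /
              (∫ u, unitDensity F γ (K + 1) u ∂fieldMeasure (F.P 0) 0 (Matrix.specialUnitaryGroup (Fin 2) ℂ)) ≤
            Real.exp (ρ K) *
            ((∫ u in {u | θBal F.L γ b₀ p₀ 0 ≤ GaugeGroup.dist1 (GaugeField.plaqHol u q)},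
                unitDensity F γ K u ∂fieldMeasure (F.P 0) 0 (Matrix.specialUnitaryGroup (Fin 2) ℂ)) /
              (∫ u, unitDensity F γ K u ∂fieldMeasure (F.P 0) 0 (Matrix.specialUnitaryGroup (Fin 2) ℂ)))) :
    Summit.QuantumFields.YangMills.Theses.UnitScaleTilt.HistoryTailL :=
  historyTailL_of_unitTop (unitTop_of_plainDensityStep hDS)

end Step

end Summit.QuantumFields.YangMills.Theorems.LargeFieldMassRefinementTailPlainStabDensity

end
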